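import Literature.MathematicalPhysics.QuantumFieldTheory.Balaban1983to89.B15Ineq184BlockAxial

/-!
# `Balaban1983to89.B15Ineq184Local` — T. Bałaban, *Large field renormalization. I. The basic step of the 𝐑 operation*,
# Commun. Math. Phys. **122** (1989) 175–202 [Balaban1989LargeFieldI], p. 197 (1.84), LOCAL CARRIER: the first input
# *"|M^j(U₀) − Q^{s*}_{k−j}V_Λ| < 11d²O(1)B₃B₅M⁵ε_k inside Λ"* and (1.84) of `B15Ineq184BlockAxial` with (1.80) assumed
# on the plaquettes of `Λ` ONLY (*"inside Λ"*), and for every orbit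

statement-level skeleton of published theorems with citation tags; proofs where landed; nothing here is a claim about the Yang–Mills mass gap

PDF held: `paper:balaban1989-cmp122-large-field-i` (journal page = PDF page + 174; p. 197 = PDF p. 23, p. 195 (1.80) =
PDF p. 21).

WHAT IS REPRODUCED (mega-formalization `lit-balaban`, HOME `run/shared/lean/pub/lit-balaban/`, Phase-2 seat p26,
generation 6; SKELETON row **B15.Eq1.84** (reader r12, referee ref-5); companion of `B15Ineq184BlockAxial` (p254385),
whose printed-constant theorems `norm_avg_sub_pull_lt` / `ineq184` / `ineq184_orbit` take (1.80) in the global sup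
form on all of `ℤ^d`).  P. 195 (1.80), verbatim: *"|U₀(∂p) − 1| < 2ε_kη² + O(1)B₃B₅M⁵ exp(−δ dist(p, Λ))ε_kη² for
p ∈ Ω_k"*; p. 197: *"Consider the configuration U₀ inside the domain Λ. We take it in the axial gauge in k-blocks, hence
|M^j(U₀) − Q^{s*}_{k−j}V_Λ| < 11d²O(1)B₃B₅M⁵ε_k inside Λ, by the estimate (1.80), and (1.65) [14]. This and (1.83) imply
|M^j(U₀) − 1| < O(1)B₃B₅M⁶ε_k inside Λ. (1.84)"*.  Here (1.80) is assumed on the unit plaquettes of `Λ` at the finest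
scale ONLY (`B7Prop1Local.pdevOn` over `Λ^{(0)} = [tlo k, thi k]`, where `dist(p, Λ) = 0`: *"|U₀(∂p) − 1| < αη²"*,
`α = (2 + O(1)B₃B₅M⁵)ε_k ≤ K·B₃B₅M⁵ε_k`), everything else as in `B15Ineq184BlockAxial` ⟹ the same conclusions on the
bonds of `Λ^{(j)}` (`norm_avg_sub_pull_lt_local`, `ineq184_local`, `ineq184_orbit_local`).  Proof = the tree's
localisation device (`B8Ineq130.ineq128_local`/`ineq130_local`): the clamped extension `π*U₀` of `U₀|Λ`
(`B7Prop1Local.clampCfg`) satisfies (1.80) everywhere (`pdev_clampCfg_le`), the global theorems apply to it, and its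
averages (`B8Ineq130.agree_level`, the printed locality of (43)) and their pull-backs (`pullIter_congr`) agree with
those of `U₀` on the tower of cubes, which transfers the gauge conditions, (1.78), and the conclusions.  For the orbit
form, the gauge `u = towerGauge L (π*U₀) k lo` of `B8Eq115GaugeFixing` puts `U₀` ITSELF in the axial gauge in
`k`-blocks inside `Λ` with `M^k(U₀^u)` axial in `Λ^{(k)}` (`gauge_inside`), and (1.84) holds for `U₀^u`.

HONEST SCOPE.  As `B15Ineq184BlockAxial` (`ℤ^d` carriers, `AvgClosed` value group, `V_Λ := M^k(U₀)`, (1.78) and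
(1.80) hypotheses of the printed shape, constants `11d²` / `11d²K + 100dK₅`); only the carrier of (1.80) changes (the
plaquettes of `Λ` instead of all of `ℤ^d`); the exponential tail of (1.80) outside `Λ` is not used.  Every declaration
is a proved theorem; no `def`, no new `Prop` fact.  Unit `lit-balaban-p26` (literature-prover-lit-balaban-p26-g6-0).
-/

noncomputable section

open scoped BigOperators
open Finset

namespace Literature.MathematicalPhysics.QuantumFieldTheory.Balaban1983to89.B15Ineq184Local

open B7Prop1Explicit B7Prop2Explicit B7Prop1Local B8Lemma1NonAbelian B8Ineq129 B8Ineq130 B8Ineq165Descent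
  B7AvgGaugeCovariance B8Eq115GaugeFixing B15Ineq184BlockAxial

-- `Site` alone would resolve to the torus sites of `Setup.lean`; re-export the `ℤ^d` sites of `B7Prop1Explicit`.
export B7Prop1Explicit (Site)

variable {d : ℕ}

/-! ## §1 Locality of the pull-back tower `Q^{s*}_n` -/

section Pull

variable {G : Type*} [Group G]

/-- **Locality of `Q^{s*}_n`** ([III] (1.3)): two coarse configurations agreeing on the bonds of the top cube
`[lo, hi]` have pull-backs `Q^{s*}_n` agreeing on the bonds of the depth-`n` cube `[tlo n, thi n]` (a pulled-back bond
variable is `1` or a top-cube bond variable). [cite: Balaban1988Convergent, (1.3) p.246] -/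
theorem pullIter_congr {L : ℕ} (hL : 1 ≤ L) {lo hi : Site d} {V V' : Site d → Fin d → G}
    (h : ∀ x ν, lo ≤ x → x + e ν ≤ hi → V x ν = V' x ν) :
    ∀ (n : ℕ) (x : Site d) (ν : Fin d), tlo L lo n ≤ x → x + e ν ≤ thi L hi n →
      pullIter L V n x ν = pullIter L V' n x ν
  | 0, x, ν, hx, hxν => by simpa using h x ν hx hxν
  | n + 1, x, ν, hx, hxν => by
    rw [pullIter_succ, pullIter_succ]
    rcases fl_add_e hL x ν with hsame | hcross
    · rw [pull_of_interior L _ hsame, pull_of_interior L _ hsame]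
    · rw [pull_of_cross _ hcross, pull_of_cross _ hcross]
      have hxhi : x ≤ thi L hi (n + 1) := le_of_add_e_le hxν
      have hxν' : tlo L lo (n + 1) ≤ x + e ν := hx.trans (le_add_of_nonneg_right (e_nonneg ν))
      obtain ⟨hz, _⟩ := fl_mem hL hx hxhi
      obtain ⟨_, hw'⟩ := fl_mem hL hxν' hxν
      rw [hcross] at hw'
      exact pullIter_congr hL h n (fl L x) ν hz hw'

end Pull

/-! ## §2 The first input of (1.84) and (1.84), (1.80) on the plaquettes of `Λ` only -/

section Local

variable {𝔸 : Type*} [NormedRing 𝔸] [NormOneClass 𝔸] [NormedAlgebra ℂ 𝔸] [CompleteSpace 𝔸]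

/-- **THE FIRST INPUT OF (1.84), printed constant, LOCAL CARRIER** — *"|M^j(U₀) − Q^{s*}_{k−j}V_Λ| <
11d²O(1)B₃B₅M⁵ε_k inside Λ, by the estimate (1.80), and (1.65) [14]"* with (1.80) assumed on the unit plaquettes of
`Λ^{(0)} = [tlo k, thi k]` only (`pdevOn … U₀ < αη²`): for every `j = k − n` and every bond `b ⊂ Λ^{(j)}`,
`|M^j(U₀)(b) − (Q^{s*}_{k−j}V_Λ)(b)| ≤ 8d²α(L^{−2(n−1)} + … + 1) < 11d²α`.  Proof: `B15Ineq184BlockAxial.norm_avg_sub_pull_lt`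
for the clamped extension `π*U₀` + locality of the averages (43) (`B8Ineq130.agree_level`) and of `Q^{s*}_n`
(`pullIter_congr`). [cite: Balaban1989LargeFieldI, p.197 ll.6–8] -/
theorem norm_avg_sub_pull_lt_local (L : ℕ) (hL : 2 ≤ L) (hd : 1 ≤ d) {G : Subgroup 𝔸ˣ} (hG : AvgClosed d L G)
    (k : ℕ) (U : Site d → Fin d → 𝔸ˣ) (hU : ∀ x κ, U x κ ∈ G) {α : ℝ} (hα : 0 < α) (hα3 : C0 d * α ≤ 1 / 3)
    (hα2 : 2 * α ≤ c2' d L) (hαs : 11 * (d : ℝ) ^ 2 * α ≤ 1 / 6) (lo hi : Site d) (hlohi : lo ≤ hi)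
    (h180 : pdevOn (tlo L lo k) (thi L hi k) U < α * (((L : ℝ) ^ k)⁻¹) ^ 2)
    (h15 : ∀ n, n < k → ∀ z, tlo L lo n ≤ z → z ≤ thi L hi n → ∀ r : Fin d → Fin L,
      axialFn (avgIter L U (k - (n + 1))) ((L : ℤ) • z) ((L : ℤ) • z + boxVec L r) = 1)
    (n : ℕ) (hn : n ≤ k) (x : Site d) (ν : Fin d) (hx : tlo L lo n ≤ x) (hxν : x + e ν ≤ thi L hi n) :
    ‖((avgIter L U (k - n) x ν : 𝔸ˣ) : 𝔸) - pullIter L (avgIter L U k) n x ν‖ ≤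
        8 * (d : ℝ) ^ 2 * α * ∑ m ∈ Finset.range n, (((L : ℝ) ^ m)⁻¹) ^ 2 ∧
      8 * (d : ℝ) ^ 2 * α * ∑ m ∈ Finset.range n, (((L : ℝ) ^ m)⁻¹) ^ 2 < 11 * (d : ℝ) ^ 2 * α := by
  have hL1 : 1 ≤ L := le_trans (by norm_num) hL
  have hUU : ∀ x κ, U x κ ∈ U1 𝔸 := fun x κ => hG.le_U1 (hU x κ)
  have hkk : ∀ i, tlo L lo k i ≤ thi L hi k i := tlo_le_thi hL1 hlohi k
  set W := clampCfg (tlo L lo k) (thi L hi k) U with hW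
  have hW' : ∀ x κ, W x κ ∈ G := clampCfg_mem hU
  have h180' : pdev W < α * (((L : ℝ) ^ k)⁻¹) ^ 2 := (pdev_clampCfg_le hkk hUU).trans_lt h180
  have hA : ∀ j m, m + j = k → AgreeOn (tlo L lo m) (thi L hi m) (avgIter L W j) (avgIter L U j) :=
    fun j m hmj => agree_level hL1 j m (by rw [hmj]; exact clampCfg_agree U)
  have h15' : ∀ n, n < k → ∀ z, tlo L lo n ≤ z → z ≤ thi L hi n → ∀ r : Fin d → Fin L,
      axialFn (avgIter L W (k - (n + 1))) ((L : ℤ) • z) ((L : ℤ) • z + boxVec L r) = 1 := by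
    intro n hn z hz hz' r
    obtain ⟨h1, h2⟩ := block_mem hz hz' r
    obtain ⟨h3, h4⟩ := smul_mem hL1 hz hz'
    rw [axialFn_congr (hA (k - (n + 1)) (n + 1) (by omega)) _ _ (inBox_of_le h3 h4) (inBox_of_le h1 h2)]
    exact h15 n hn z hz hz' r
  have hmain := norm_avg_sub_pull_lt L hL hd hG k W hW' hα hα3 hα2 hαs h180' lo hi h15' n hn x ν hx hxν
  have hbx := inBox_of_le hx (le_of_add_e_le hxν)
  have hbx' := inBox_of_le (hx.trans (le_add_of_nonneg_right (e_nonneg ν))) hxν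
  have htop : ∀ x ν, lo ≤ x → x + e ν ≤ hi → avgIter L W k x ν = avgIter L U k x ν := fun x ν hx hxν =>
    hA k 0 (by simp) x ν (by simpa using inBox_of_le hx (le_of_add_e_le hxν))
      (by simpa using inBox_of_le (hx.trans (le_add_of_nonneg_right (e_nonneg ν))) hxν)
  rwa [hA (k - n) n (by omega) x ν hbx hbx', pullIter_congr hL1 htop n x ν hx hxν] at hmain

/-- **(1.84) BY NAME, LOCAL CARRIER** — the typed leaf `B15.BasicStep.Ineq184 |M^j(U₀)(b) − 1| (11d²K + 100dK₅) B₃ B₅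
M ε_k` on every bond `b ⊂ Λ^{(j)}`, from: (1.80) on the plaquettes of `Λ` only (`pdevOn … U₀ < αη²`, `α ≤
K·B₃B₅M⁵ε_k`), *"the axial gauge in k-blocks"* inside `Λ`, (1.78) for `V_Λ = M^k(U₀)` on `Λ^{(k)}` (`a₀ ≤ K₅·B₅M⁵ε_k`,
`D ≤ 100M`) and the axial gauge of `V_Λ` in `Λ^{(k)}` — `B15Ineq184BlockAxial.ineq184` for the clamped extension,
transferred by locality. [cite: Balaban1989LargeFieldI, (1.84) p.197] -/
theorem ineq184_local (L : ℕ) (hL : 2 ≤ L) (hd : 1 ≤ d) {G : Subgroup 𝔸ˣ} (hG : AvgClosed d L G) (k : ℕ)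
    (U : Site d → Fin d → 𝔸ˣ) (hU : ∀ x κ, U x κ ∈ G) {α : ℝ} (hα : 0 < α) (hα3 : C0 d * α ≤ 1 / 3)
    (hα2 : 2 * α ≤ c2' d L) (hαs : 11 * (d : ℝ) ^ 2 * α ≤ 1 / 6) (lo hi : Site d) (hlohi : lo ≤ hi)
    (h180 : pdevOn (tlo L lo k) (thi L hi k) U < α * (((L : ℝ) ^ k)⁻¹) ^ 2)
    (h15 : ∀ n, n < k → ∀ z, tlo L lo n ≤ z → z ≤ thi L hi n → ∀ r : Fin d → Fin L,
      axialFn (avgIter L U (k - (n + 1))) ((L : ℤ) • z) ((L : ℤ) • z + boxVec L r) = 1)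
    (hgax : ∀ x, lo ≤ x → x ≤ hi → axialFn (avgIter L U k) lo x = 1)
    {D : ℕ} (hwidth : ∀ κ, hi κ ≤ lo κ + D) {a₀ : ℝ} (ha₀0 : 0 ≤ a₀)
    (hreg : B8Lemma1NonAbelian.PlaqSmall (avgIter L U k) lo hi a₀)
    {K K₅ B₃ B₅ M εk : ℝ} (hK : 0 < K) (hK₅ : 0 < K₅) (hB₃ : 1 ≤ B₃) (hB₅ : 0 < B₅) (hM : 1 ≤ M)
    (hεk : 0 < εk) (hαK : α ≤ K * B₃ * B₅ * M ^ 5 * εk) (ha₀ : a₀ ≤ K₅ * B₅ * M ^ 5 * εk)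
    (hD : (D : ℝ) ≤ 100 * M)
    (n : ℕ) (hn : n ≤ k) (x : Site d) (ν : Fin d) (hx : tlo L lo n ≤ x) (hxν : x + e ν ≤ thi L hi n) :
    B15.BasicStep.Ineq184 ‖((avgIter L U (k - n) x ν : 𝔸ˣ) : 𝔸) - 1‖ (11 * (d : ℝ) ^ 2 * K + 100 * d * K₅)
      B₃ B₅ M εk := by
  have hL1 : 1 ≤ L := le_trans (by norm_num) hL
  have hL' : (0 : ℝ) < L := by exact_mod_cast lt_of_lt_of_le (by norm_num) hL
  have hUU : ∀ x κ, U x κ ∈ U1 𝔸 := fun x κ => hG.le_U1 (hU x κ)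
  have hkk : ∀ i, tlo L lo k i ≤ thi L hi k i := tlo_le_thi hL1 hlohi k
  set W := clampCfg (tlo L lo k) (thi L hi k) U with hW
  have hW' : ∀ x κ, W x κ ∈ G := clampCfg_mem hU
  have h180' : pdev W < α * (((L : ℝ) ^ k)⁻¹) ^ 2 := (pdev_clampCfg_le hkk hUU).trans_lt h180
  have hA : ∀ j m, m + j = k → AgreeOn (tlo L lo m) (thi L hi m) (avgIter L W j) (avgIter L U j) :=
    fun j m hmj => agree_level hL1 j m (by rw [hmj]; exact clampCfg_agree U)
  have h15' : ∀ n, n < k → ∀ z, tlo L lo n ≤ z → z ≤ thi L hi n → ∀ r : Fin d → Fin L,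
      axialFn (avgIter L W (k - (n + 1))) ((L : ℤ) • z) ((L : ℤ) • z + boxVec L r) = 1 := by
    intro n hn z hz hz' r
    obtain ⟨h1, h2⟩ := block_mem hz hz' r
    obtain ⟨h3, h4⟩ := smul_mem hL1 hz hz'
    rw [axialFn_congr (hA (k - (n + 1)) (n + 1) (by omega)) _ _ (inBox_of_le h3 h4) (inBox_of_le h1 h2)]
    exact h15 n hn z hz hz' r
  have hA0 : AgreeOn lo hi (avgIter L W k) (avgIter L U k) := by simpa using hA k 0 (by simp)
  have hgax' : ∀ x, lo ≤ x → x ≤ hi → axialFn (avgIter L W k) lo x = 1 := by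
    intro x hx hx'
    rw [axialFn_congr hA0 lo x (inBox_of_le le_rfl hlohi) (inBox_of_le hx hx')]
    exact hgax x hx hx'
  -- Prop. 2 membership of the top average of the clamped field (for `Hyp183.unit`)
  have hdiv : α / (L : ℝ) ^ 2 * (L : ℝ) ^ 2 = α := div_mul_cancel₀ _ (pow_ne_zero 2 hL'.ne')
  have hβ : 0 < α / (L : ℝ) ^ 2 := by positivity
  have hα3' : C0 d * (α / (L : ℝ) ^ 2 * (L : ℝ) ^ 2) ≤ 1 / 3 := by rw [hdiv]; exact hα3
  have hα2' : 2 * (α / (L : ℝ) ^ 2 * (L : ℝ) ^ 2) ≤ c2' d L := by rw [hdiv]; exact hα2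
  have h17' : pdev W < α / (L : ℝ) ^ 2 * (L : ℝ) ^ 2 * (((L : ℝ) ^ k)⁻¹) ^ 2 := by rwa [hdiv]
  have hmemG := (ineq128_global L hL hG k W hW' hβ hα3' hα2' h17' 0 (Nat.zero_le k)).2
  have H : B15Ineq183AxialGauge.Hyp183 (avgIter L W k) lo hi D a₀ :=
    ⟨fun x κ => hG.le_U1 (hmemG k (by simp) x κ), hwidth,
      fun x κ μ hκμ hx hx' => by
        have hxx : x ≤ x + e κ + e μ :=
          (le_add_of_nonneg_right (e_nonneg κ)).trans (le_add_of_nonneg_right (e_nonneg μ))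
        rw [hol_plaqWord_congr hA0 x κ μ (inBox_of_le hx (hxx.trans hx')) (inBox_of_le (hx.trans hxx) hx')]
        exact hreg x κ μ hκμ hx hx',
      ha₀0⟩
  have hmain := ineq184 L hL hd hG k W hW' hα hα3 hα2 hαs h180' lo hi h15' H hgax' hK hK₅ hB₃ hB₅ hM hεk hαK
    ha₀ hD n hn x ν hx hxν
  have hbx := inBox_of_le hx (le_of_add_e_le hxν)
  have hbx' := inBox_of_le (hx.trans (le_add_of_nonneg_right (e_nonneg ν))) hxν
  rwa [hA (k - n) n (by omega) x ν hbx hbx'] at hmain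

/-! ## §3 For every orbit, (1.80) on the plaquettes of `Λ` only -/

/-- **The gauge of the orbit form is a gauge for `U₀` ITSELF inside `Λ`**: with `u = towerGauge L (π*U₀) k lo`
(`π*U₀` the clamped extension of `U₀|Λ`, `B7Prop1Local.clampCfg`), the configuration `U₀^u` is in the axial gauge in
`k`-blocks over the cubes `Λ^{(j)}` ((1.15) of [14]) and `M^k(U₀^u)` is in the axial gauge of `Λ^{(k)}` rooted at `lo`
— by `B8Eq115GaugeFixing.gaugeFix_global` for `π*U₀` and the locality of the averages (43) (the two fields `(π*U₀)^u`,
`U₀^u` agree on `Λ`). [cite: Balaban1989LargeFieldI, p.197 ll.2–6] -/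
theorem gauge_inside (L : ℕ) (hL : 2 ≤ L) {G : Subgroup 𝔸ˣ} (hG : AvgClosed d L G) (k : ℕ)
    (U : Site d → Fin d → 𝔸ˣ) (hU : ∀ x κ, U x κ ∈ G) {α : ℝ} (hα : 0 < α) (hα3 : C0 d * α ≤ 1 / 3)
    (hα2 : 2 * α ≤ c2' d L) (lo hi : Site d) (hlohi : lo ≤ hi)
    (h180 : pdevOn (tlo L lo k) (thi L hi k) U < α * (((L : ℝ) ^ k)⁻¹) ^ 2) :
    (∀ n, n < k → ∀ z, tlo L lo n ≤ z → z ≤ thi L hi n → ∀ r : Fin d → Fin L,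
      axialFn (avgIter L (gaugeAct (towerGauge L (clampCfg (tlo L lo k) (thi L hi k) U) k lo) U) (k - (n + 1)))
        ((L : ℤ) • z) ((L : ℤ) • z + boxVec L r) = 1) ∧
    (∀ x, lo ≤ x → x ≤ hi →
      axialFn (avgIter L (gaugeAct (towerGauge L (clampCfg (tlo L lo k) (thi L hi k) U) k lo) U) k) lo x = 1) := by
  have hL1 : 1 ≤ L := le_trans (by norm_num) hL
  have hL' : (0 : ℝ) < L := by exact_mod_cast lt_of_lt_of_le (by norm_num) hL
  have hUU : ∀ x κ, U x κ ∈ U1 𝔸 := fun x κ => hG.le_U1 (hU x κ)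
  have hkk : ∀ i, tlo L lo k i ≤ thi L hi k i := tlo_le_thi hL1 hlohi k
  set W := clampCfg (tlo L lo k) (thi L hi k) U with hW
  have hW' : ∀ x κ, W x κ ∈ G := clampCfg_mem hU
  have hdiv : α / (L : ℝ) ^ 2 * (L : ℝ) ^ 2 = α := div_mul_cancel₀ _ (pow_ne_zero 2 hL'.ne')
  have hβ : 0 < α / (L : ℝ) ^ 2 := by positivity
  have hα3' : C0 d * (α / (L : ℝ) ^ 2 * (L : ℝ) ^ 2) ≤ 1 / 3 := by rw [hdiv]; exact hα3
  have hα2' : 2 * (α / (L : ℝ) ^ 2 * (L : ℝ) ^ 2) ≤ c2' d L := by rw [hdiv]; exact hα2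
  have h17' : pdev W < α / (L : ℝ) ^ 2 * (L : ℝ) ^ 2 * (((L : ℝ) ^ k)⁻¹) ^ 2 := by
    rw [hdiv]; exact (pdev_clampCfg_le hkk hUU).trans_lt h180
  obtain ⟨_, _, _, _, h15, htop⟩ := gaugeFix_global L hL hG k W hW' hβ hα3' hα2' h17' lo
  set u := towerGauge L W k lo with hu
  -- the two gauge-transformed fields agree on `Λ`, hence their averages agree on the tower
  have hA : ∀ j m, m + j = k →
      AgreeOn (tlo L lo m) (thi L hi m) (avgIter L (gaugeAct u W) j) (avgIter L (gaugeAct u U) j) :=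
    fun j m hmj => agree_level hL1 j m (by rw [hmj]; exact gaugeAct_agree (clampCfg_agree U) u)
  refine ⟨fun n hn z hz hz' r => ?_, fun x hx hx' => ?_⟩
  · obtain ⟨h1, h2⟩ := block_mem hz hz' r
    obtain ⟨h3, h4⟩ := smul_mem hL1 hz hz'
    rw [← axialFn_congr (hA (k - (n + 1)) (n + 1) (by omega)) _ _ (inBox_of_le h3 h4) (inBox_of_le h1 h2)]
    exact h15 n hn z r
  · have hA0 : AgreeOn lo hi (avgIter L (gaugeAct u W) k) (avgIter L (gaugeAct u U) k) := by
      simpa using hA k 0 (by simp)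
    rw [← axialFn_congr hA0 lo x (inBox_of_le le_rfl hlohi) (inBox_of_le hx hx')]
    exact htop x

/-- **(1.84) FOR EVERY ORBIT, LOCAL CARRIER**: for EVERY `G`-valued `U₀` with (1.80) on the plaquettes of `Λ` only
(`pdevOn … U₀ < αη²`, `α ≤ K·B₃B₅M⁵ε_k`) and (1.78) for `M^k(U₀)` on `Λ^{(k)}` (`a₀ ≤ K₅·B₅M⁵ε_k`, `D ≤ 100M`), the
representative `U₀^u`, `u = towerGauge L (π*U₀) k lo` (in the axial gauge in `k`-blocks inside `Λ` with `M^k` axial in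
`Λ^{(k)}`: `gauge_inside`), satisfies `B15.BasicStep.Ineq184 |M^j(U₀^u)(b) − 1| (11d²K + 100dK₅) B₃ B₅ M ε_k` on every
bond `b ⊂ Λ^{(j)}` — `B15Ineq184BlockAxial.ineq184_orbit` for `π*U₀`, transferred by locality.
[cite: Balaban1989LargeFieldI, (1.84) p.197] -/
theorem ineq184_orbit_local (L : ℕ) (hL : 2 ≤ L) (hd : 1 ≤ d) {G : Subgroup 𝔸ˣ} (hG : AvgClosed d L G) (k : ℕ)
    (U : Site d → Fin d → 𝔸ˣ) (hU : ∀ x κ, U x κ ∈ G) {α : ℝ} (hα : 0 < α) (hα3 : C0 d * α ≤ 1 / 3)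
    (hα2 : 2 * α ≤ c2' d L) (hαs : 11 * (d : ℝ) ^ 2 * α ≤ 1 / 6) (lo hi : Site d) (hlohi : lo ≤ hi)
    (h180 : pdevOn (tlo L lo k) (thi L hi k) U < α * (((L : ℝ) ^ k)⁻¹) ^ 2)
    {D : ℕ} (hwidth : ∀ κ, hi κ ≤ lo κ + D) {a₀ : ℝ} (ha₀0 : 0 ≤ a₀)
    (hreg : B8Lemma1NonAbelian.PlaqSmall (avgIter L U k) lo hi a₀)
    {K K₅ B₃ B₅ M εk : ℝ} (hK : 0 < K) (hK₅ : 0 < K₅) (hB₃ : 1 ≤ B₃) (hB₅ : 0 < B₅) (hM : 1 ≤ M)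
    (hεk : 0 < εk) (hαK : α ≤ K * B₃ * B₅ * M ^ 5 * εk) (ha₀ : a₀ ≤ K₅ * B₅ * M ^ 5 * εk)
    (hD : (D : ℝ) ≤ 100 * M)
    (n : ℕ) (hn : n ≤ k) (x : Site d) (ν : Fin d) (hx : tlo L lo n ≤ x) (hxν : x + e ν ≤ thi L hi n) :
    B15.BasicStep.Ineq184
      ‖((avgIter L (gaugeAct (towerGauge L (clampCfg (tlo L lo k) (thi L hi k) U) k lo) U) (k - n) x ν : 𝔸ˣ) :
          𝔸) - 1‖
      (11 * (d : ℝ) ^ 2 * K + 100 * d * K₅) B₃ B₅ M εk := by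
  have hL1 : 1 ≤ L := le_trans (by norm_num) hL
  have hUU : ∀ x κ, U x κ ∈ U1 𝔸 := fun x κ => hG.le_U1 (hU x κ)
  have hkk : ∀ i, tlo L lo k i ≤ thi L hi k i := tlo_le_thi hL1 hlohi k
  set W := clampCfg (tlo L lo k) (thi L hi k) U with hW
  have hW' : ∀ x κ, W x κ ∈ G := clampCfg_mem hU
  have h180' : pdev W < α * (((L : ℝ) ^ k)⁻¹) ^ 2 := (pdev_clampCfg_le hkk hUU).trans_lt h180
  have hA0 : AgreeOn lo hi (avgIter L W k) (avgIter L U k) := by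
    simpa using agree_level hL1 k 0 (by simpa using clampCfg_agree (lo := tlo L lo k) (hi := thi L hi k) U)
  have hreg' : B8Lemma1NonAbelian.PlaqSmall (avgIter L W k) lo hi a₀ := fun x κ μ hκμ hx hx' => by
    have hxx : x ≤ x + e κ + e μ :=
      (le_add_of_nonneg_right (e_nonneg κ)).trans (le_add_of_nonneg_right (e_nonneg μ))
    rw [hol_plaqWord_congr hA0 x κ μ (inBox_of_le hx (hxx.trans hx')) (inBox_of_le (hx.trans hxx) hx')]
    exact hreg x κ μ hκμ hx hx'
  have hmain := ineq184_orbit L hL hd hG k W hW' hα hα3 hα2 hαs h180' lo hi hwidth ha₀0 hreg' hK hK₅ hB₃ hB₅ hM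
    hεk hαK ha₀ hD n hn x ν hx hxν
  set u := towerGauge L W k lo with hu
  have hA : AgreeOn (tlo L lo n) (thi L hi n) (avgIter L (gaugeAct u W) (k - n)) (avgIter L (gaugeAct u U) (k - n)) :=
    agree_level hL1 (k - n) n (by
      rw [show n + (k - n) = k by omega]; exact gaugeAct_agree (clampCfg_agree U) u)
  have hbx := inBox_of_le hx (le_of_add_e_le hxν)
  have hbx' := inBox_of_le (hx.trans (le_add_of_nonneg_right (e_nonneg ν))) hxν
  rwa [hA x ν hbx hbx'] at hmain

end Local

end Literature.MathematicalPhysics.QuantumFieldTheory.Balaban1983to89.B15Ineq184Local
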